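import Mathlib.Analysis.Complex.ExponentialBounds
import Mathlib.Analysis.SpecialFunctions.ExpDeriv
import Literature.NumberTheory.LFunctions.DeBruijnPhiComplexHead
import HarnessLib

/-!
# The complex Pólya–de Bruijn kernel `Φ_C`: the derivative `Φ_C′` as a series in the strip `|Im u| < π/8`

Topic `Literature/NumberTheory/LFunctions`; sequel of `DeBruijnPhiComplex.lean` (holomorphy of `Φ_C` on `|Im u| < π/8`)
and `DeBruijnPhiComplexHead.lean` (dominance of the first theta term `a₁`). For the saddle-point analysis of
`Φ`-weighted integrals on a shifted horizontal contour (route `rh-jensen`, crux `XiWindowZeroFreeRelFar`) the PHASE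
`log Φ_C` enters through its derivative: the saddle equation and the descent estimates need `(log Φ_C)′ = Φ_C′/Φ_C`
explicitly. We prove:

* `deBruijnPhiDerivSummandC n u = (30π²(n+1)⁴e^{9u} − 15π(n+1)²e^{5u} − 8π³(n+1)⁶e^{13u})·exp(−π(n+1)²e^{4u})`
  is the derivative of the `n`-th summand (`hasDerivAt_deBruijnPhiSummandC`), with strip majorant
  `norm_deBruijnPhiDerivSummandC_le`;
* `hasDerivAt_deBruijnPhiC`: for `|Im u| < π/8`, `Φ_C` has derivative `deBruijnPhiDerivC u = ∑' n, deBruijnPhiDerivSummandC n u`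
  (termwise differentiation, Mathlib `Complex.hasSum_deriv_of_summable_norm` on a box);
* the strip majorant of the derivative summands is summable (`summable_deBruijnPhiDerivStripMajorant`), so the
  derivative series converges absolutely (`summable_norm_deBruijnPhiDerivSummandC`); `deriv_deBruijnPhiC`.
The head dominance of `Φ_C′` and the envelope of `(log Φ_C)′ = Φ_C′/Φ_C` are in the sequel `DeBruijnPhiComplexLogDeriv.lean`.

## References

* E. C. Titchmarsh, *The Theory of the Riemann Zeta-Function*, 2nd ed. (1986), §10.1. [Titchmarsh1986]
* M. W. Coffey, G. Csordas, *On the log-concavity of a Jacobi theta function*, Math. Comp. 82 (2013), Prop. 2.1, (2.9)–(2.10). [CoffeyCsordas2013]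
* N. G. de Bruijn, *The roots of trigonometric integrals*, Duke Math. J. 17 (1950). [deBruijn1950]
-/

noncomputable section

open Complex Real Set Filter Topology

namespace Literature.NumberTheory.LFunctions

/-! ## 1. The derivative of one summand -/

/-- The derivative of the `n`-th summand of `Φ_C`:
`(30π²(n+1)⁴e^{9u} − 15π(n+1)²e^{5u} − 8π³(n+1)⁶e^{13u})·exp(−π(n+1)²e^{4u})` (= `−eᵘ(8Y³ − 30Y² + 15Y)e^{−Y}`,
`Y = π(n+1)²e^{4u}`). [cite: CoffeyCsordas2013, (2.10)] -/
def deBruijnPhiDerivSummandC (n : ℕ) (u : ℂ) : ℂ :=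
  (((30 * π ^ 2 * ((n : ℝ) + 1) ^ 4 : ℝ) : ℂ) * Complex.exp (9 * u) -
      ((15 * π * ((n : ℝ) + 1) ^ 2 : ℝ) : ℂ) * Complex.exp (5 * u) -
      ((8 * π ^ 3 * ((n : ℝ) + 1) ^ 6 : ℝ) : ℂ) * Complex.exp (13 * u)) *
    Complex.exp (-(((π * ((n : ℝ) + 1) ^ 2 : ℝ) : ℂ) * Complex.exp (4 * u)))

/-- `Φ_C′ := ∑_n (summand_n)′` (it IS the derivative of `Φ_C` on the strip: `hasDerivAt_deBruijnPhiC`).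
[cite: Titchmarsh1986, §10.1] -/
def deBruijnPhiDerivC (u : ℂ) : ℂ :=
  ∑' n : ℕ, deBruijnPhiDerivSummandC n u

/-- `d/du (numeral·u) = numeral`. [folklore] -/
private theorem hasDerivAt_cexp_const_mul (c : ℂ) (u : ℂ) :
    HasDerivAt (fun w : ℂ => Complex.exp (c * w)) (Complex.exp (c * u) * c) u := by
  have h : HasDerivAt (fun w : ℂ => c * w) c u := by simpa using (hasDerivAt_id u).const_mul c
  simpa using h.cexp

/-- **Each summand is differentiable with the stated derivative.** [cite: CoffeyCsordas2013, (2.9)–(2.10)] -/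
theorem hasDerivAt_deBruijnPhiSummandC (n : ℕ) (u : ℂ) :
    HasDerivAt (deBruijnPhiSummandC n) (deBruijnPhiDerivSummandC n u) u := by
  set a : ℂ := ((2 * π ^ 2 * ((n : ℝ) + 1) ^ 4 : ℝ) : ℂ) with ha
  set b : ℂ := ((3 * π * ((n : ℝ) + 1) ^ 2 : ℝ) : ℂ) with hb
  set c : ℂ := ((π * ((n : ℝ) + 1) ^ 2 : ℝ) : ℂ) with hc
  have h9 := hasDerivAt_cexp_const_mul 9 u
  have h5 := hasDerivAt_cexp_const_mul 5 u
  have h4 := hasDerivAt_cexp_const_mul 4 u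
  have hF : HasDerivAt (fun w : ℂ => a * Complex.exp (9 * w) - b * Complex.exp (5 * w))
      (a * (Complex.exp (9 * u) * 9) - b * (Complex.exp (5 * u) * 5)) u :=
    (h9.const_mul a).sub (h5.const_mul b)
  have hG : HasDerivAt (fun w : ℂ => Complex.exp (-(c * Complex.exp (4 * w))))
      (Complex.exp (-(c * Complex.exp (4 * u))) * (-(c * (Complex.exp (4 * u) * 4)))) u :=
    ((h4.const_mul c).neg).cexp
  have h := hF.mul hG
  have ef : deBruijnPhiSummandC n = fun w : ℂ =>
      (a * Complex.exp (9 * w) - b * Complex.exp (5 * w)) * Complex.exp (-(c * Complex.exp (4 * w))) := by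
    funext w; simp only [deBruijnPhiSummandC, ha, hb, hc]
  rw [ef]
  refine h.congr_deriv ?_
  have e13 : Complex.exp (13 * u) = Complex.exp (9 * u) * Complex.exp (4 * u) := by
    rw [← Complex.exp_add]; ring_nf
  have e9 : Complex.exp (9 * u) = Complex.exp (5 * u) * Complex.exp (4 * u) := by
    rw [← Complex.exp_add]; ring_nf
  have hca : c * a * 4 = ((8 * π ^ 3 * ((n : ℝ) + 1) ^ 6 : ℝ) : ℂ) := by
    rw [hc, ha]; push_cast; ring
  have hcb : c * b * 4 = ((12 * π ^ 2 * ((n : ℝ) + 1) ^ 4 : ℝ) : ℂ) := by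
    rw [hc, hb]; push_cast; ring
  have h30 : ((30 * π ^ 2 * ((n : ℝ) + 1) ^ 4 : ℝ) : ℂ) = a * 9 + c * b * 4 := by
    rw [ha, hb, hc]; push_cast; ring
  have h15 : ((15 * π * ((n : ℝ) + 1) ^ 2 : ℝ) : ℂ) = b * 5 := by
    rw [hb]; push_cast; ring
  unfold deBruijnPhiDerivSummandC
  rw [h30, h15, ← hca, e13, ← hc, e9]
  ring

/-! ## 2. The strip majorant of the derivative summand -/

/-- The strip majorant of `(summand_n)′` at `u = x + iy`:
`(30π²(n+1)⁴e^{9x} + 15π(n+1)²e^{5x} + 8π³(n+1)⁶e^{13x})·exp(−π(n+1)²e^{4x}cos 4y)`. [cite: Titchmarsh1986, §10.1] -/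
def deBruijnPhiDerivStripMajorant (x y : ℝ) (n : ℕ) : ℝ :=
  (30 * π ^ 2 * ((n : ℝ) + 1) ^ 4 * Real.exp (9 * x) + 15 * π * ((n : ℝ) + 1) ^ 2 * Real.exp (5 * x) +
      8 * π ^ 3 * ((n : ℝ) + 1) ^ 6 * Real.exp (13 * x)) *
    Real.exp (-(π * ((n : ℝ) + 1) ^ 2 * Real.exp (4 * x) * Real.cos (4 * y)))

/-- **Termwise strip bound for the derivative**: `‖(summand_n)′(u)‖ ≤ majorant′(Re u, Im u, n)`.
[cite: Titchmarsh1986, §10.1] -/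
theorem norm_deBruijnPhiDerivSummandC_le (n : ℕ) (u : ℂ) :
    ‖deBruijnPhiDerivSummandC n u‖ ≤ deBruijnPhiDerivStripMajorant u.re u.im n := by
  have hA : 0 ≤ 30 * π ^ 2 * ((n : ℝ) + 1) ^ 4 := by positivity
  have hB : 0 ≤ 15 * π * ((n : ℝ) + 1) ^ 2 := by positivity
  have hC : 0 ≤ 8 * π ^ 3 * ((n : ℝ) + 1) ^ 6 := by positivity
  have h9 : ‖((30 * π ^ 2 * ((n : ℝ) + 1) ^ 4 : ℝ) : ℂ) * Complex.exp (9 * u)‖ =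
      30 * π ^ 2 * ((n : ℝ) + 1) ^ 4 * Real.exp (9 * u.re) := by
    rw [norm_mul, Complex.norm_real, Real.norm_of_nonneg hA, norm_cexp_ofNat_mul]
  have h5 : ‖((15 * π * ((n : ℝ) + 1) ^ 2 : ℝ) : ℂ) * Complex.exp (5 * u)‖ =
      15 * π * ((n : ℝ) + 1) ^ 2 * Real.exp (5 * u.re) := by
    rw [norm_mul, Complex.norm_real, Real.norm_of_nonneg hB, norm_cexp_ofNat_mul]
  have h13 : ‖((8 * π ^ 3 * ((n : ℝ) + 1) ^ 6 : ℝ) : ℂ) * Complex.exp (13 * u)‖ =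
      8 * π ^ 3 * ((n : ℝ) + 1) ^ 6 * Real.exp (13 * u.re) := by
    rw [norm_mul, Complex.norm_real, Real.norm_of_nonneg hC, norm_cexp_ofNat_mul]
  unfold deBruijnPhiDerivSummandC deBruijnPhiDerivStripMajorant
  rw [norm_mul, norm_cexp_deBruijnGaussFactor]
  gcongr
  calc _ ≤ ‖((30 * π ^ 2 * ((n : ℝ) + 1) ^ 4 : ℝ) : ℂ) * Complex.exp (9 * u) -
          ((15 * π * ((n : ℝ) + 1) ^ 2 : ℝ) : ℂ) * Complex.exp (5 * u)‖ +
        ‖((8 * π ^ 3 * ((n : ℝ) + 1) ^ 6 : ℝ) : ℂ) * Complex.exp (13 * u)‖ := norm_sub_le _ _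
    _ ≤ (‖((30 * π ^ 2 * ((n : ℝ) + 1) ^ 4 : ℝ) : ℂ) * Complex.exp (9 * u)‖ +
          ‖((15 * π * ((n : ℝ) + 1) ^ 2 : ℝ) : ℂ) * Complex.exp (5 * u)‖) +
        ‖((8 * π ^ 3 * ((n : ℝ) + 1) ^ 6 : ℝ) : ℂ) * Complex.exp (13 * u)‖ := by
        gcongr; exact norm_sub_le _ _
    _ = _ := by rw [h9, h5, h13]

/-- The derivative majorant is non-negative. [cite: Titchmarsh1986, §10.1] -/
theorem deBruijnPhiDerivStripMajorant_nonneg (x y : ℝ) (n : ℕ) : 0 ≤ deBruijnPhiDerivStripMajorant x y n := by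
  unfold deBruijnPhiDerivStripMajorant; positivity

/-- **Summability of the derivative majorant** for `|y| < π/8`. [cite: Titchmarsh1986, §10.1] -/
theorem summable_deBruijnPhiDerivStripMajorant (x : ℝ) {y : ℝ} (hy : |y| < π / 8) :
    Summable (deBruijnPhiDerivStripMajorant x y) := by
  set r : ℝ := π * Real.exp (4 * x) * Real.cos (4 * y) with hr
  have hrpos : 0 < r := by have := cos_four_mul_pos hy; have := Real.pi_pos; positivity
  have h4 := (summable_succ_pow_mul_exp_neg_mul_sq 4 hrpos).mul_left (30 * π ^ 2 * Real.exp (9 * x))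
  have h2 := (summable_succ_pow_mul_exp_neg_mul_sq 2 hrpos).mul_left (15 * π * Real.exp (5 * x))
  have h6 := (summable_succ_pow_mul_exp_neg_mul_sq 6 hrpos).mul_left (8 * π ^ 3 * Real.exp (13 * x))
  refine ((h4.add h2).add h6).congr fun n => ?_
  unfold deBruijnPhiDerivStripMajorant
  rw [hr]; ring_nf

/-- The derivative series converges absolutely on the strip. [cite: Titchmarsh1986, §10.1] -/
theorem summable_norm_deBruijnPhiDerivSummandC {u : ℂ} (hu : |u.im| < π / 8) :
    Summable fun n => ‖deBruijnPhiDerivSummandC n u‖ :=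
  (summable_deBruijnPhiDerivStripMajorant u.re hu).of_nonneg_of_le (fun _ => norm_nonneg _)
    fun n => norm_deBruijnPhiDerivSummandC_le n u

/-! ## 3. `Φ_C′ = ∑ (summand)′` on the strip -/

/-- **Termwise differentiation**: for `|Im u| < π/8`, `HasDerivAt Φ_C (∑' n, (summand_n)′(u)) u`
(Mathlib's `Complex.hasSum_deriv_of_summable_norm` on the box `Re ∈ (x₀ − 1, x₀ + 1)`, `|Im| < (π/8 + |y₀|)/2`, with the
uniform majorant of `DeBruijnPhiComplex`). [cite: Titchmarsh1986, §10.1] -/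
theorem hasDerivAt_deBruijnPhiC {u₀ : ℂ} (hu₀ : |u₀.im| < π / 8) :
    HasDerivAt deBruijnPhiC (deBruijnPhiDerivC u₀) u₀ := by
  set x₀ : ℝ := u₀.re with hx₀
  set y₁ : ℝ := (π / 8 + |u₀.im|) / 2 with hy₁def
  have hy₁lt : y₁ < π / 8 := by rw [hy₁def]; linarith
  have hy₀lt : |u₀.im| < y₁ := by rw [hy₁def]; linarith
  have hy₁pi : 4 * y₁ ≤ π / 2 := by linarith [Real.pi_pos]
  have hy₁abs : |y₁| < π / 8 := by
    rw [abs_of_nonneg (by linarith [abs_nonneg u₀.im])]; exact hy₁lt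
  set U : Set ℂ := {u : ℂ | u.re ∈ Set.Ioo (x₀ - 1) (x₀ + 1) ∧ |u.im| < y₁} with hU
  have hUo : IsOpen U := by
    refine IsOpen.inter (isOpen_Ioo.preimage Complex.continuous_re) ?_
    exact isOpen_lt (continuous_abs.comp Complex.continuous_im) continuous_const
  have hu₀U : u₀ ∈ U := ⟨⟨by linarith, by linarith⟩, hy₀lt⟩
  set M : ℕ → ℝ := fun n =>
    (2 * π ^ 2 * ((n : ℝ) + 1) ^ 4 * Real.exp (9 * (x₀ + 1)) +
        3 * π * ((n : ℝ) + 1) ^ 2 * Real.exp (5 * (x₀ + 1))) *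
      Real.exp (-(π * ((n : ℝ) + 1) ^ 2 * Real.exp (4 * (x₀ - 1)) * Real.cos (4 * y₁))) with hM
  have hMsum : Summable M := by
    set r : ℝ := π * Real.exp (4 * (x₀ - 1)) * Real.cos (4 * y₁) with hr
    have hrpos : 0 < r := by
      have := cos_four_mul_pos hy₁abs
      positivity
    have h4 := (summable_succ_pow_mul_exp_neg_mul_sq 4 hrpos).mul_left
      (2 * π ^ 2 * Real.exp (9 * (x₀ + 1)))
    have h2 := (summable_succ_pow_mul_exp_neg_mul_sq 2 hrpos).mul_left
      (3 * π * Real.exp (5 * (x₀ + 1)))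
    refine (h4.add h2).congr fun n => ?_
    rw [hM, hr]
    ring_nf
  have hle : ∀ (n : ℕ) (w : ℂ), w ∈ U → ‖deBruijnPhiSummandC n w‖ ≤ M n := by
    rintro n w ⟨⟨hw₁, hw₂⟩, hw₃⟩
    exact (norm_deBruijnPhiSummandC_le n w).trans
      (deBruijnPhiStripMajorant_le hw₁.le hw₂.le hw₃.le hy₁pi n)
  have hsum := Complex.hasSum_deriv_of_summable_norm hMsum
    (fun n => (differentiable_deBruijnPhiSummandC n).differentiableOn) hUo hle hu₀U
  have ed : (fun n => deriv (deBruijnPhiSummandC n) u₀) = fun n => deBruijnPhiDerivSummandC n u₀ :=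
    funext fun n => (hasDerivAt_deBruijnPhiSummandC n u₀).deriv
  have ef : (fun w : ℂ => ∑' n : ℕ, deBruijnPhiSummandC n w) = deBruijnPhiC := by
    funext w; rfl
  rw [ed, ef] at hsum
  have hval : deriv deBruijnPhiC u₀ = deBruijnPhiDerivC u₀ := hsum.tsum_eq.symm
  rw [← hval]
  exact (differentiableAt_deBruijnPhiC hu₀).hasDerivAt

/-- `deriv Φ_C = Φ_C′` on the strip. [cite: Titchmarsh1986, §10.1] -/
theorem deriv_deBruijnPhiC {u : ℂ} (hu : |u.im| < π / 8) : deriv deBruijnPhiC u = deBruijnPhiDerivC u :=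
  (hasDerivAt_deBruijnPhiC hu).deriv

end Literature.NumberTheory.LFunctions

end
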